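import Literature.ModelTheory.ExponentialFields.SemialgebraicRichCuts
import Literature.ModelTheory.ExponentialFields.SemialgebraicFibreSmoothing
import HarnessLib

/-!
# Tools for Pawłucki's lenses: distance functions, parametric minima, parametric inverses

Topic `Literature/ModelTheory/ExponentialFields` — block B2b (tools) of the proof of the
`C¹`-triangulation theorem for compact semialgebraic sets
(`Literature.ModelTheory.ExponentialFields.OhmotoShiota2017_c1Triangulation`, statement of
[OhmotoShiota2017, Thm. 1.1]) along the proof of [Pawlucki2024], specialized to `p = 1`.

The lens of [Pawlucki2024, Prop. 2.5, proof, Part I] is built from the distance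
`d((a, t), K ∖ V)` to the complement of a member of the cover, its running minimum along a
fibre segment (to make it monotone) and the inverse of the resulting strictly increasing fibre
function.  This file supplies the three tools in the two layers used throughout the route:

* `isSemialgebraicFunOn_infDist`: the distance `z ↦ infDist z C` (sup metric of `ℝⁿ`) to a
  semialgebraic set is semialgebraic (and continuous, Mathlib);
* `continuousOn_paramMin` / `isSemialgebraicFunOn_paramMin`: the running minimum
  `(y, t) ↦ min_{s ∈ [t, T y]} F(y, s)`;
* `continuousOn_paramInv` / `isSemialgebraicFunOn_paramInv`: the fibrewise inverse of a jointly
  continuous, fibrewise strictly increasing function over a locally compact base.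

No named facts are introduced (D-0026).

## References

* [Pawlucki2024] W. Pawłucki, *Strict `C^p`-triangulations — a new approach to
  desingularization*, J. Eur. Math. Soc. 26 (2024), 3863–3909, Prop. 2.5 (proof, Part I).
* [BochnakCosteRoy1998] J. Bochnak, M. Coste, M.-F. Roy, *Real Algebraic Geometry*, §2.2
  (Tarski–Seidenberg; Prop. 2.2.8: distance to a semialgebraic set).
* [OhmotoShiota2017] T. Ohmoto, M. Shiota, *`C¹`-triangulations of semialgebraic sets*,
  J. Topology 10 (2017), Thm. 1.1 (statement only).
-/

noncomputable section

open Set Filter Metric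
open _root_.Topology

namespace Literature.ModelTheory.ExponentialFields

open Literature.NumberTheory.Transcendental (IsSemialgebraicFunOn IsSemialgebraicMapOn
  isSemialgebraicFunOn_iff)
open Literature.NumberTheory.Transcendental.SemialgebraicMonotonicity (sa_and sa_or sa_not sa_imp
  sa_lt sa_le sa_eq sa_sub_lt sa_reindex sa_exists sa_forall sa_const_lt sa_lt_const sa_le_const
  sa_const_le)

section InfDist

variable {n : ℕ}

/-- The atom `|w α - w β| < w γ` is semialgebraic. [cite: BochnakCosteRoy1998, §2.1] -/
theorem sa_abs_sub_lt {p : ℕ} (α β γ : Fin p) :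
    IsSemialgebraic ℝ {w : Fin p → ℝ | |w α - w β| < w γ} := by
  have h := sa_and (sa_sub_lt α β γ) (sa_sub_lt β α γ)
  convert h using 1
  ext w
  simp only [mem_setOf_eq, abs_sub_lt_iff]

/-- The relation `dist z c < r` between two blocks of coordinates and a coordinate (sup metric)
is semialgebraic. [cite: BochnakCosteRoy1998, §2.2] -/
theorem sa_dist_lt {p : ℕ} (zI cI : Fin n → Fin p) (rI : Fin p) :
    IsSemialgebraic ℝ {w : Fin p → ℝ | dist (fun i => w (zI i)) (fun i => w (cI i)) < w rI} := by
  classical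
  have h : IsSemialgebraic ℝ ({w : Fin p → ℝ | 0 < w rI} ∩
      ⋂ i ∈ (Finset.univ : Finset (Fin n)), {w : Fin p → ℝ | |w (zI i) - w (cI i)| < w rI}) :=
    (sa_const_lt rI 0).inter (IsSemialgebraic.biInter _ _ fun i _ => sa_abs_sub_lt (zI i) (cI i) rI)
  convert h using 1
  ext w
  simp only [mem_setOf_eq, mem_inter_iff, mem_iInter, Finset.mem_univ, forall_true_left]
  constructor
  · intro hw
    have hr : 0 < w rI := lt_of_le_of_lt dist_nonneg hw
    exact ⟨hr, fun i => by simpa [Real.dist_eq] using (dist_pi_lt_iff hr).1 hw i⟩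
  · rintro ⟨hr, hw⟩
    exact (dist_pi_lt_iff hr).2 fun i => by simpa [Real.dist_eq] using hw i

/-- **The distance to a semialgebraic set is a semialgebraic function** (sup metric of `ℝⁿ`).
[cite: BochnakCosteRoy1998, Prop. 2.2.8] -/
theorem isSemialgebraicFunOn_infDist {C : Set (Fin n → ℝ)} (hC : IsSemialgebraic ℝ C) :
    IsSemialgebraicFunOn ℝ univ (fun z : Fin n → ℝ => infDist z C) := by
  classical
  rcases C.eq_empty_or_nonempty with rfl | hne
  · simp only [infDist_empty]
    exact isSemialgebraicFunOn_const' (isSemialgebraic_univ (k := ℝ) (ι := Fin n)) (0 : ℝ)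
  rw [isSemialgebraicFunOn_iff]
  -- first-order description of `r = infDist z C`
  have key : ∀ (z : Fin n → ℝ) (r : ℝ), r = infDist z C ↔
      (∀ c : Fin n → ℝ, c ∈ C → ¬ dist z c < r) ∧ (∀ s : ℝ, r < s → ∃ c : Fin n → ℝ, c ∈ C ∧ dist z c < s) := by
    intro z r
    constructor
    · rintro rfl
      exact ⟨fun c hc hlt => absurd (infDist_le_dist_of_mem hc) (not_le.2 hlt),
        fun s hs => (infDist_lt_iff hne).1 hs⟩
    · rintro ⟨h1, h2⟩
      apply le_antisymm
      · by_contra hlt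
        rw [not_le] at hlt
        obtain ⟨c, hc, hcd⟩ := (infDist_lt_iff hne).1 hlt
        exact h1 c hc hcd
      · by_contra hlt
        rw [not_le] at hlt
        obtain ⟨c, hc, hcd⟩ := h2 _ hlt
        exact absurd (infDist_le_dist_of_mem hc) (not_le.2 hcd)
  -- the two conjuncts as semialgebraic subsets of `ℝⁿ⁺¹`
  have hA : IsSemialgebraic ℝ {q : Fin (n + 1) → ℝ |
      ∀ c : Fin n → ℝ, c ∈ C → ¬ dist (Fin.init q) c < q (Fin.last n)} := by
    have h := sa_forall_block (m := n + 1) (n := n)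
      (P := fun q c => c ∈ C → ¬ dist (Fin.init q) c < q (Fin.last n)) ?_
    · exact h
    refine sa_imp ?_ (sa_not ?_)
    · have h := sa_reindex (n := n + 1 + n) (P := fun c : Fin n → ℝ => c ∈ C) hC (Fin.natAdd (n + 1))
      exact h
    · have h := sa_dist_lt (n := n) (p := n + 1 + n) (fun i => Fin.castAdd n (Fin.castSucc i))
        (fun i => Fin.natAdd (n + 1) i) (Fin.castAdd n (Fin.last n))
      exact h
  have hB : IsSemialgebraic ℝ {q : Fin (n + 1) → ℝ |
      ∀ s : ℝ, q (Fin.last n) < s → ∃ c : Fin n → ℝ, c ∈ C ∧ dist (Fin.init q) c < s} := by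
    refine sa_forall (n := n + 1) (P := fun q s => q (Fin.last n) < s →
      ∃ c : Fin n → ℝ, c ∈ C ∧ dist (Fin.init q) c < s) ?_
    refine sa_imp ?_ ?_
    · have h := sa_lt (n := n + 1 + 1) (Fin.castSucc (Fin.last n)) (Fin.last (n + 1))
      exact h
    · have h := sa_exists_block (m := n + 1 + 1) (n := n)
        (P := fun w c => c ∈ C ∧ dist (Fin.init (Fin.init w)) c < w (Fin.last (n + 1))) ?_
      · exact h
      refine sa_and ?_ ?_
      · exact sa_reindex (n := n + 1 + 1 + n) (P := fun c : Fin n → ℝ => c ∈ C) hC (Fin.natAdd (n + 1 + 1))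
      · have h := sa_dist_lt (n := n) (p := n + 1 + 1 + n)
          (fun i => Fin.castAdd n (Fin.castSucc (Fin.castSucc i)))
          (fun i => Fin.natAdd (n + 1 + 1) i) (Fin.castAdd n (Fin.last (n + 1)))
        exact h
  convert hA.inter hB using 1
  ext q
  simp only [mem_setOf_eq, mem_univ, true_and, mem_inter_iff]
  exact key (Fin.init q) (q (Fin.last n))

/-- The distance to the complement of an open set is positive exactly on the set.
[cite: BochnakCosteRoy1998, §2.2] -/
theorem infDist_compl_pos_iff {X : Type*} [MetricSpace X] {V : Set X} (hV : IsOpen V)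
    (hne : Vᶜ.Nonempty) {x : X} : 0 < infDist x Vᶜ ↔ x ∈ V := by
  rw [← hV.isClosed_compl.notMem_iff_infDist_pos hne, notMem_compl_iff]

/-- Points within the distance to the complement lie in the set. [cite: BochnakCosteRoy1998, §2.2] -/
theorem mem_of_dist_lt_infDist_compl {X : Type*} [MetricSpace X] {V : Set X} {x y : X}
    (h : dist x y < infDist x Vᶜ) : y ∈ V := by
  have := notMem_of_dist_lt_infDist h
  rwa [notMem_compl_iff] at this

end InfDist

/-! ### Parametric running minimum -/

section ParamMin

variable {X : Type*}

/-- The running minimum `min_{s ∈ [t, T y]} F(y, s)` (as an `sInf` of the image).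
[cite: Pawlucki2024, Prop. 2.5 (proof, Part I)] -/
def paramMin (F : X → ℝ → ℝ) (T : X → ℝ) (y : X) (t : ℝ) : ℝ := sInf (F y '' Icc t (T y))

variable {F : X → ℝ → ℝ} {T lo : X → ℝ} {S : Set X} {y : X} {t : ℝ}

/-- The running minimum is attained. [cite: Pawlucki2024, Prop. 2.5 (proof, Part I)] -/
theorem exists_paramMin_eq (hF : ContinuousOn (F y) (Icc t (T y))) (ht : t ≤ T y) :
    ∃ s ∈ Icc t (T y), paramMin F T y t = F y s := by
  obtain ⟨s, hs, hmin⟩ := (isCompact_Icc (a := t) (b := T y)).exists_isMinOn (nonempty_Icc.2 ht) hF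
  refine ⟨s, hs, le_antisymm ?_ ?_⟩
  · exact csInf_le ((isCompact_Icc.image_of_continuousOn hF).bddBelow) ⟨s, hs, rfl⟩
  · refine le_csInf ((nonempty_Icc.2 ht).image _) ?_
    rintro _ ⟨s', hs', rfl⟩
    exact hmin hs'

/-- The running minimum is a lower bound. [cite: Pawlucki2024, Prop. 2.5 (proof, Part I)] -/
theorem paramMin_le (hF : ContinuousOn (F y) (Icc t (T y))) {s : ℝ} (hs : s ∈ Icc t (T y)) :
    paramMin F T y t ≤ F y s :=
  csInf_le ((isCompact_Icc.image_of_continuousOn hF).bddBelow) ⟨s, hs, rfl⟩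

/-- Characterisation of the running minimum by first-order conditions.
[cite: Pawlucki2024, Prop. 2.5 (proof, Part I)] -/
theorem paramMin_eq_iff (hF : ContinuousOn (F y) (Icc t (T y))) (ht : t ≤ T y) {r : ℝ} :
    r = paramMin F T y t ↔ (∃ s ∈ Icc t (T y), F y s = r) ∧ ∀ s ∈ Icc t (T y), r ≤ F y s := by
  constructor
  · rintro rfl
    obtain ⟨s, hs, h⟩ := exists_paramMin_eq hF ht
    exact ⟨⟨s, hs, h.symm⟩, fun s hs => paramMin_le hF hs⟩
  · rintro ⟨⟨s, hs, rfl⟩, h⟩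
    apply le_antisymm
    · obtain ⟨s', hs', h'⟩ := exists_paramMin_eq hF ht
      rw [h']; exact h s' hs'
    · exact paramMin_le hF hs

/-- The running minimum is monotone (nondecreasing) in `t`. [cite: Pawlucki2024, Prop. 2.5] -/
theorem paramMin_mono (hF : ContinuousOn (F y) (Icc t (T y))) {t' : ℝ} (htt' : t ≤ t') (ht' : t' ≤ T y) :
    paramMin F T y t ≤ paramMin F T y t' := by
  obtain ⟨s, hs, h⟩ := exists_paramMin_eq (hF.mono (Icc_subset_Icc_left htt')) ht'
  rw [h]
  exact paramMin_le hF ⟨htt'.trans hs.1, hs.2⟩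

/-- At the top the running minimum is the value. [cite: Pawlucki2024, Prop. 2.5] -/
theorem paramMin_top (y : X) : paramMin F T y (T y) = F y (T y) := by
  unfold paramMin
  rw [Icc_self, image_singleton, csInf_singleton]

/-- **Joint continuity of the running minimum** on `{(y, t) : y ∈ S, lo y ≤ t ≤ T y}`.
[cite: Pawlucki2024, Prop. 2.5 (proof, Part I)] -/
theorem continuousOn_paramMin [TopologicalSpace X] (hT : ContinuousOn T S)
    (hF : ContinuousOn (fun p : X × ℝ => F p.1 p.2) {p | p.1 ∈ S ∧ lo p.1 ≤ p.2 ∧ p.2 ≤ T p.1}) :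
    ContinuousOn (fun p : X × ℝ => paramMin F T p.1 p.2) {p | p.1 ∈ S ∧ lo p.1 ≤ p.2 ∧ p.2 ≤ T p.1} := by
  set R : Set (X × ℝ) := {p | p.1 ∈ S ∧ lo p.1 ≤ p.2 ∧ p.2 ≤ T p.1} with hR
  -- reparametrise the interval `[t, T y]` by `θ ∈ [0, 1]`
  let H : ↥R → ℝ → ℝ := fun p θ => F p.1.1 (p.1.2 + max 0 (min θ 1) * (T p.1.1 - p.1.2))
  have hHc : Continuous fun q : ↥R × ℝ => H q.1 q.2 := by
    have h1 : Continuous fun q : ↥R × ℝ => (q.1 : X × ℝ).1 := continuous_fst.comp (continuous_subtype_val.comp continuous_fst)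
    have h2 : Continuous fun q : ↥R × ℝ => (q.1 : X × ℝ).2 := continuous_snd.comp (continuous_subtype_val.comp continuous_fst)
    have hθ : Continuous fun q : ↥R × ℝ => max 0 (min q.2 1) :=
      continuous_const.max (continuous_snd.min continuous_const)
    have hTc : Continuous fun q : ↥R × ℝ => T (q.1 : X × ℝ).1 :=
      hT.comp_continuous h1 fun q => q.1.2.1
    have harg : Continuous fun q : ↥R × ℝ => ((q.1 : X × ℝ).1, (q.1 : X × ℝ).2 +
        max 0 (min q.2 1) * (T (q.1 : X × ℝ).1 - (q.1 : X × ℝ).2)) :=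
      h1.prodMk (h2.add (hθ.mul (hTc.sub h2)))
    refine hF.comp_continuous harg fun q => ?_
    obtain ⟨hS, h1', h2'⟩ := q.1.2
    have hθ0 : 0 ≤ max 0 (min q.2 1) := le_max_left _ _
    have hθ1 : max 0 (min q.2 1) ≤ 1 := max_le zero_le_one (min_le_right _ _)
    refine ⟨hS, ?_, ?_⟩
    · nlinarith
    · nlinarith
  have hcont := (isCompact_Icc (a := (0:ℝ)) (b := 1)).continuous_sInf (f := H) hHc
  -- identify with `paramMin`
  have heq : ∀ p : ↥R, sInf (H p '' Icc 0 1) = paramMin F T (p.1.1) (p.1.2) := by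
    intro p
    obtain ⟨hS, h1', h2'⟩ := p.2
    unfold paramMin
    congr 1
    ext v
    constructor
    · rintro ⟨θ, hθ, rfl⟩
      have hθ' : max 0 (min θ 1) = θ := by
        rw [min_eq_left hθ.2, max_eq_right hθ.1]
      refine ⟨p.1.2 + θ * (T p.1.1 - p.1.2), ⟨by nlinarith [hθ.1], by nlinarith [hθ.2]⟩, ?_⟩
      simp only [H, hθ']
    · rintro ⟨s, hs, rfl⟩
      rcases eq_or_lt_of_le h2' with heq | hlt
      · refine ⟨0, ⟨le_rfl, zero_le_one⟩, ?_⟩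
        have : s = p.1.2 := le_antisymm (heq ▸ hs.2) hs.1
        simp [H, this]
      · refine ⟨(s - p.1.2) / (T p.1.1 - p.1.2), ⟨div_nonneg (by linarith [hs.1]) (by linarith),
          (div_le_one (by linarith)).2 (by linarith [hs.2])⟩, ?_⟩
        have hθ' : max 0 (min ((s - p.1.2) / (T p.1.1 - p.1.2)) 1) = (s - p.1.2) / (T p.1.1 - p.1.2) := by
          rw [min_eq_left ((div_le_one (by linarith)).2 (by linarith [hs.2])),
            max_eq_right (div_nonneg (by linarith [hs.1]) (by linarith))]
        simp only [H, hθ']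
        congr 1
        field_simp
        ring
  rw [continuousOn_iff_continuous_restrict]
  convert hcont using 1
  funext p
  exact (heq p).symm

end ParamMin

/-! ### Parametric running minimum: semialgebraicity (snoc coordinates) -/

section ParamMinSA

variable {m : ℕ}

/-- Coordinate embedding `(y, s) ↦` positions in `w = (y, t, r, s) ∈ ℝ^{m+3}`. [folklore] -/
def pmσT (m : ℕ) : Fin (m + 1) → Fin (m + 1 + 1 + 1) :=
  Fin.snoc (fun i : Fin m => Fin.castSucc (Fin.castSucc (Fin.castSucc i))) (Fin.last (m + 1 + 1))

/-- Coordinate embedding `(y, s, r) ↦` positions in `w = (y, t, r, s) ∈ ℝ^{m+3}`. [folklore] -/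
def pmσF (m : ℕ) : Fin (m + 1 + 1) → Fin (m + 1 + 1 + 1) :=
  Fin.snoc (pmσT m) (Fin.castSucc (Fin.last (m + 1)))

/-- `w ∘ pmσT = (y, s)`. [folklore] -/
theorem comp_pmσT (w : Fin (m + 1 + 1 + 1) → ℝ) :
    w ∘ pmσT m = Fin.snoc (Fin.init (Fin.init (Fin.init w))) (w (Fin.last (m + 1 + 1))) := by
  funext i
  refine Fin.lastCases ?_ (fun i => ?_) i
  · simp [pmσT]
  · simp [pmσT, Fin.init]

/-- `w ∘ pmσF = (y, s, r)`. [folklore] -/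
theorem comp_pmσF (w : Fin (m + 1 + 1 + 1) → ℝ) :
    w ∘ pmσF m = Fin.snoc (Fin.snoc (Fin.init (Fin.init (Fin.init w))) (w (Fin.last (m + 1 + 1))))
      (w (Fin.castSucc (Fin.last (m + 1)))) := by
  funext i
  refine Fin.lastCases ?_ (fun i => ?_) i
  · simp [pmσF]
  · have h := congrFun (comp_pmσT w) i
    simp only [Function.comp_apply] at h
    simp only [pmσF, Function.comp_apply, Fin.snoc_castSucc]
    rw [h]

/-- **Semialgebraicity of the running minimum** `z = (y, t) ↦ min_{s ∈ [t, T y]} F(y, s)` on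
`{(y,t) : y ∈ S, lo y ≤ t ≤ T y}`, for `F` semialgebraic in `(y, s)` (everywhere) and continuous
along the fibre segments. [cite: Pawlucki2024, Prop. 2.5 (proof, Part I)] -/
theorem isSemialgebraicFunOn_paramMin {S : Set (Fin m → ℝ)}
    {F : (Fin m → ℝ) → ℝ → ℝ} {lo T : (Fin m → ℝ) → ℝ}
    (hlo : IsSemialgebraicFunOn ℝ S lo) (hT : IsSemialgebraicFunOn ℝ S T)
    (hF : IsSemialgebraicFunOn ℝ univ (fun z : Fin (m + 1) → ℝ => F (Fin.init z) (z (Fin.last m))))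
    (hFc : ∀ y ∈ S, ContinuousOn (F y) (Icc (lo y) (T y))) :
    IsSemialgebraicFunOn ℝ {z : Fin (m + 1) → ℝ | Fin.init z ∈ S ∧ lo (Fin.init z) ≤ z (Fin.last m) ∧
      z (Fin.last m) ≤ T (Fin.init z)} (fun z => paramMin F T (Fin.init z) (z (Fin.last m))) := by
  classical
  set R : Set (Fin (m + 1) → ℝ) := {z | Fin.init z ∈ S ∧ lo (Fin.init z) ≤ z (Fin.last m) ∧
    z (Fin.last m) ≤ T (Fin.init z)} with hR_def
  have hR : IsSemialgebraic ℝ R := by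
    have h1 := IsSemialgebraicFunOn.isSemialgebraic_setOf_ge tarski_seidenberg_real_holds hlo
    have h2 := IsSemialgebraicFunOn.isSemialgebraic_setOf_le tarski_seidenberg_real_holds hT
    convert h1.inter h2 using 1
    ext z; simp only [hR_def, mem_setOf_eq, mem_inter_iff]; tauto
  -- graph and closed hypograph of `F̂ (y, s) = F y s`, and hypograph of `T`
  have hΓF : IsSemialgebraic ℝ {u : Fin (m + 1 + 1) → ℝ |
      u (Fin.last (m + 1)) = F (Fin.init (Fin.init u)) (Fin.init u (Fin.last m))} := by
    have h := isSemialgebraicFunOn_iff.mp hF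
    convert h using 1
    ext u; simp
  have hHF : IsSemialgebraic ℝ {u : Fin (m + 1 + 1) → ℝ |
      u (Fin.last (m + 1)) ≤ F (Fin.init (Fin.init u)) (Fin.init u (Fin.last m))} := by
    have h := IsSemialgebraicFunOn.isSemialgebraic_setOf_le tarski_seidenberg_real_holds hF
    convert h using 1
    ext u; simp
  have hHT : IsSemialgebraic ℝ {u : Fin (m + 1) → ℝ | Fin.init u ∈ S ∧ u (Fin.last m) ≤ T (Fin.init u)} :=
    IsSemialgebraicFunOn.isSemialgebraic_setOf_le tarski_seidenberg_real_holds hT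
  -- reindexed versions inside `w = (y, t, r, s)`
  have hT' : IsSemialgebraic ℝ {w : Fin (m + 1 + 1 + 1) → ℝ |
      Fin.init (Fin.init (Fin.init w)) ∈ S ∧ w (Fin.last (m + 1 + 1)) ≤ T (Fin.init (Fin.init (Fin.init w)))} := by
    have h := hHT.preimage_comp (pmσT m)
    convert h using 1
    ext w
    simp only [mem_setOf_eq, mem_preimage, comp_pmσT, Fin.init_snoc, Fin.snoc_last]
  have hF' : IsSemialgebraic ℝ {w : Fin (m + 1 + 1 + 1) → ℝ |
      w (Fin.castSucc (Fin.last (m + 1))) = F (Fin.init (Fin.init (Fin.init w))) (w (Fin.last (m + 1 + 1)))} := by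
    have h := hΓF.preimage_comp (pmσF m)
    convert h using 1
    ext w
    simp only [mem_setOf_eq, mem_preimage, comp_pmσF, Fin.init_snoc, Fin.snoc_last]
  have hF'' : IsSemialgebraic ℝ {w : Fin (m + 1 + 1 + 1) → ℝ |
      w (Fin.castSucc (Fin.last (m + 1))) ≤ F (Fin.init (Fin.init (Fin.init w))) (w (Fin.last (m + 1 + 1)))} := by
    have h := hHF.preimage_comp (pmσF m)
    convert h using 1
    ext w
    simp only [mem_setOf_eq, mem_preimage, comp_pmσF, Fin.init_snoc, Fin.snoc_last]
  have ht_le_s : IsSemialgebraic ℝ {w : Fin (m + 1 + 1 + 1) → ℝ |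
      w (Fin.castSucc (Fin.castSucc (Fin.last m))) ≤ w (Fin.last (m + 1 + 1))} :=
    sa_le (n := m + 1 + 1 + 1) _ _
  -- (A) the minimum is attained: ∃ s, t ≤ s ∧ (y ∈ S ∧ s ≤ T y) ∧ F y s = r
  have hA : IsSemialgebraic ℝ {q : Fin (m + 1 + 1) → ℝ | ∃ s : ℝ,
      Fin.init q (Fin.last m) ≤ s ∧ (Fin.init (Fin.init q) ∈ S ∧ s ≤ T (Fin.init (Fin.init q))) ∧
        q (Fin.last (m + 1)) = F (Fin.init (Fin.init q)) s} := by
    refine sa_exists (n := m + 1 + 1) (P := fun q s =>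
      Fin.init q (Fin.last m) ≤ s ∧ (Fin.init (Fin.init q) ∈ S ∧ s ≤ T (Fin.init (Fin.init q))) ∧
        q (Fin.last (m + 1)) = F (Fin.init (Fin.init q)) s) ?_
    exact ht_le_s.inter (hT'.inter hF')
  -- (B) the minimum is a lower bound: ∀ s, t ≤ s → (y ∈ S ∧ s ≤ T y) → r ≤ F y s
  have hB : IsSemialgebraic ℝ {q : Fin (m + 1 + 1) → ℝ | ∀ s : ℝ,
      Fin.init q (Fin.last m) ≤ s → (Fin.init (Fin.init q) ∈ S ∧ s ≤ T (Fin.init (Fin.init q))) →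
        q (Fin.last (m + 1)) ≤ F (Fin.init (Fin.init q)) s} := by
    refine sa_forall (n := m + 1 + 1) (P := fun q s =>
      Fin.init q (Fin.last m) ≤ s → (Fin.init (Fin.init q) ∈ S ∧ s ≤ T (Fin.init (Fin.init q))) →
        q (Fin.last (m + 1)) ≤ F (Fin.init (Fin.init q)) s) ?_
    exact sa_imp ht_le_s (sa_imp hT' hF'')
  rw [isSemialgebraicFunOn_iff]
  convert hR.setOf_init_mem.inter (hA.inter hB) using 1
  ext q
  simp only [mem_setOf_eq, mem_inter_iff]
  constructor
  · rintro ⟨hqR, hq⟩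
    have hyS : Fin.init (Fin.init q) ∈ S := hqR.1
    have ht : Fin.init q (Fin.last m) ≤ T (Fin.init (Fin.init q)) := hqR.2.2
    have hc : ContinuousOn (F (Fin.init (Fin.init q))) (Icc (Fin.init q (Fin.last m)) (T (Fin.init (Fin.init q)))) :=
      (hFc _ hyS).mono (Icc_subset_Icc_left hqR.2.1)
    obtain ⟨⟨s, hs, hsF⟩, hlow⟩ := (paramMin_eq_iff hc ht).1 hq
    refine ⟨hqR, ⟨s, hs.1, ⟨hyS, hs.2⟩, hsF.symm⟩, fun s h1 h2 => hlow s ⟨h1, h2.2⟩⟩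
  · rintro ⟨hqR, ⟨s, hs1, ⟨hyS, hs2⟩, hsF⟩, hlow⟩
    refine ⟨hqR, ?_⟩
    have ht : Fin.init q (Fin.last m) ≤ T (Fin.init (Fin.init q)) := hqR.2.2
    have hc : ContinuousOn (F (Fin.init (Fin.init q))) (Icc (Fin.init q (Fin.last m)) (T (Fin.init (Fin.init q)))) :=
      (hFc _ hyS).mono (Icc_subset_Icc_left hqR.2.1)
    exact (paramMin_eq_iff hc ht).2 ⟨⟨s, ⟨hs1, hs2⟩, hsF.symm⟩, fun s hs => hlow s hs.1 ⟨hyS, hs.2⟩⟩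

end ParamMinSA

/-! ### Parametric inverse of a fibrewise strictly increasing function -/

section ParamInv

variable {X : Type*}

/-- The region `{(x, t) : x ∈ S, lo x ≤ t ≤ hi x}`. [cite: Pawlucki2024, Prop. 2.5 (proof, Part I)] -/
def piRegion (S : Set X) (lo hi : X → ℝ) : Set (X × ℝ) := {p | p.1 ∈ S ∧ lo p.1 ≤ p.2 ∧ p.2 ≤ hi p.1}

/-- **The fibrewise inverse** `ψ(x, r)` of `φ(x, ·)` on `[lo x, hi x]` (second component of the
partial inverse of `(x, t) ↦ (x, φ(x,t))`). [cite: Pawlucki2024, Prop. 2.5 (proof, Part I)] -/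
def paramInv [Nonempty X] (S : Set X) (lo hi : X → ℝ) (φ : X → ℝ → ℝ) (x : X) (r : ℝ) : ℝ :=
  (Function.invFunOn (fun p : X × ℝ => (p.1, φ p.1 p.2)) (piRegion S lo hi) (x, r)).2

variable [Nonempty X] {S : Set X} {lo hi : X → ℝ} {φ : X → ℝ → ℝ}

omit [Nonempty X] in
/-- The partial map `(x, t) ↦ (x, φ(x, t))` is injective on the region. [cite: Pawlucki2024, Prop. 2.5] -/
theorem injOn_piMap (hmono : ∀ x ∈ S, StrictMonoOn (φ x) (Icc (lo x) (hi x))) :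
    InjOn (fun p : X × ℝ => (p.1, φ p.1 p.2)) (piRegion S lo hi) := by
  rintro ⟨x, t⟩ hp ⟨x', t'⟩ hq h
  simp only [Prod.mk.injEq] at h
  obtain ⟨rfl, h⟩ := h
  simp only [Prod.mk.injEq, true_and]
  exact (hmono x hp.1).injOn ⟨hp.2.1, hp.2.2⟩ ⟨hq.2.1, hq.2.2⟩ h

omit [Nonempty X] in
/-- The image of the region is the region between the transformed bounds.
[cite: Pawlucki2024, Prop. 2.5] -/
theorem image_piMap (hmono : ∀ x ∈ S, StrictMonoOn (φ x) (Icc (lo x) (hi x)))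
    (hle : ∀ x ∈ S, lo x ≤ hi x) (hc : ∀ x ∈ S, ContinuousOn (φ x) (Icc (lo x) (hi x))) :
    (fun p : X × ℝ => (p.1, φ p.1 p.2)) '' piRegion S lo hi =
      piRegion S (fun x => φ x (lo x)) (fun x => φ x (hi x)) := by
  ext ⟨x, r⟩
  constructor
  · rintro ⟨⟨x', t⟩, hp, h⟩
    simp only [Prod.mk.injEq] at h
    obtain ⟨rfl, rfl⟩ := h
    have hm := (hmono _ hp.1).monotoneOn
    exact ⟨hp.1, hm ⟨le_rfl, hle _ hp.1⟩ ⟨hp.2.1, hp.2.2⟩ hp.2.1, hm ⟨hp.2.1, hp.2.2⟩ ⟨hle _ hp.1, le_rfl⟩ hp.2.2⟩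
  · rintro ⟨hx, h1, h2⟩
    obtain ⟨t, ht, htr⟩ := intermediate_value_Icc (hle x hx) (hc x hx) ⟨h1, h2⟩
    exact ⟨(x, t), ⟨hx, ht.1, ht.2⟩, by simp [htr]⟩

/-- **Specification of the inverse**: `ψ(x, r) ∈ [lo x, hi x]` and `φ(x, ψ(x, r)) = r`.
[cite: Pawlucki2024, Prop. 2.5] -/
theorem paramInv_spec (hmono : ∀ x ∈ S, StrictMonoOn (φ x) (Icc (lo x) (hi x)))
    (hle : ∀ x ∈ S, lo x ≤ hi x) (hc : ∀ x ∈ S, ContinuousOn (φ x) (Icc (lo x) (hi x)))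
    {x : X} (hx : x ∈ S) {r : ℝ} (hr : r ∈ Icc (φ x (lo x)) (φ x (hi x))) :
    paramInv S lo hi φ x r ∈ Icc (lo x) (hi x) ∧ φ x (paramInv S lo hi φ x r) = r := by
  set E := fun p : X × ℝ => (p.1, φ p.1 p.2) with hE
  have hmem : (x, r) ∈ E '' piRegion S lo hi := by
    rw [image_piMap hmono hle hc]; exact ⟨hx, hr.1, hr.2⟩
  have h1 : Function.invFunOn E (piRegion S lo hi) (x, r) ∈ piRegion S lo hi := Function.invFunOn_mem hmem
  have h2 : E (Function.invFunOn E (piRegion S lo hi) (x, r)) = (x, r) := Function.invFunOn_eq hmem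
  simp only [hE, Prod.mk.injEq] at h2
  have hfst : (Function.invFunOn E (piRegion S lo hi) (x, r)).1 = x := h2.1
  constructor
  · have : (x, paramInv S lo hi φ x r) = Function.invFunOn E (piRegion S lo hi) (x, r) := by
      ext
      · exact hfst.symm
      · rfl
    have h1' := h1
    rw [← this] at h1'
    exact ⟨h1'.2.1, h1'.2.2⟩
  · have h := h2.2
    rw [hfst] at h
    exact h

/-- `ψ(x, φ(x, t)) = t`. [cite: Pawlucki2024, Prop. 2.5] -/
theorem paramInv_apply (hmono : ∀ x ∈ S, StrictMonoOn (φ x) (Icc (lo x) (hi x)))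
    {x : X} (hx : x ∈ S) {t : ℝ} (ht : t ∈ Icc (lo x) (hi x)) :
    paramInv S lo hi φ x (φ x t) = t := by
  have h := (injOn_piMap hmono).leftInvOn_invFunOn (⟨hx, ht.1, ht.2⟩ : (x, t) ∈ piRegion S lo hi)
  unfold paramInv
  rw [h]

/-- `ψ(x, ·)` is strictly increasing. [cite: Pawlucki2024, Prop. 2.5] -/
theorem paramInv_strictMonoOn (hmono : ∀ x ∈ S, StrictMonoOn (φ x) (Icc (lo x) (hi x)))
    (hle : ∀ x ∈ S, lo x ≤ hi x) (hc : ∀ x ∈ S, ContinuousOn (φ x) (Icc (lo x) (hi x)))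
    {x : X} (hx : x ∈ S) :
    StrictMonoOn (paramInv S lo hi φ x) (Icc (φ x (lo x)) (φ x (hi x))) := by
  intro r hr r' hr' hrr'
  by_contra h
  have hle' := le_of_not_gt h
  have h1 := paramInv_spec hmono hle hc hx hr
  have h2 := paramInv_spec hmono hle hc hx hr'
  have hm := (hmono x hx).monotoneOn h2.1 h1.1 hle'
  rw [h1.2, h2.2] at hm
  exact absurd hrr' (not_lt.2 hm)

/-- **Joint continuity of the fibrewise inverse** over a base that is locally compact (in the
relative sense: every point has a compact relative neighbourhood), e.g. an open subset of `ℝᵏ`.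
[cite: Pawlucki2024, Prop. 2.5 (proof, Part I)] -/
theorem continuousOn_paramInv [TopologicalSpace X] [T2Space X] (hmono : ∀ x ∈ S, StrictMonoOn (φ x) (Icc (lo x) (hi x)))
    (hle : ∀ x ∈ S, lo x ≤ hi x) (hlo : ContinuousOn lo S) (hhi : ContinuousOn hi S)
    (hφ : ContinuousOn (fun p : X × ℝ => φ p.1 p.2) (piRegion S lo hi))
    (hlc : ∀ x ∈ S, ∃ K ⊆ S, IsCompact K ∧ K ∈ 𝓝[S] x) :
    ContinuousOn (fun p : X × ℝ => paramInv S lo hi φ p.1 p.2)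
      (piRegion S (fun x => φ x (lo x)) (fun x => φ x (hi x))) := by
  have hc : ∀ x ∈ S, ContinuousOn (φ x) (Icc (lo x) (hi x)) := fun x hx =>
    hφ.comp (continuousOn_const.prodMk continuousOn_id) fun t (ht : t ∈ Icc _ _) => ⟨hx, ht.1, ht.2⟩
  rintro ⟨x₀, r₀⟩ hp₀
  obtain ⟨K, hKS, hK, hKn⟩ := hlc x₀ hp₀.1
  set E := fun p : X × ℝ => (p.1, φ p.1 p.2) with hE
  -- the compact sub-region over `K`
  have hRK : IsCompact (piRegion K lo hi) := by
    have h := isCompact_lamTotal (α := fun j : ℕ => if j = 0 then lo else hi) hK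
      (fun j => by by_cases hj : j = 0 <;> simp [hj, hlo.mono hKS, hhi.mono hKS])
      (fun x hx j j' hjj' => by
        by_cases hj : j = 0
        · by_cases hj' : j' = 0
          · simp [hj, hj']
          · simp [hj, hj', hle x (hKS hx)]
        · have hj' : j' ≠ 0 := fun h => hj (by omega)
          simp [hj, hj'])
      1
    convert h using 1
    ext p
    simp [piRegion, lamTotal]
  have hEK : ContinuousOn E (piRegion K lo hi) :=
    continuousOn_fst.prodMk (hφ.mono fun p (hp : p ∈ piRegion K lo hi) => (⟨hKS hp.1, hp.2⟩ : p ∈ piRegion S lo hi))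
  have hinjK : InjOn E (piRegion K lo hi) :=
    (injOn_piMap hmono).mono fun p (hp : p ∈ piRegion K lo hi) => (⟨hKS hp.1, hp.2⟩ : p ∈ piRegion S lo hi)
  have hcontK := continuousOn_invFunOn_of_isCompact_injOn hRK hEK hinjK
  have himK : E '' piRegion K lo hi = piRegion K (fun x => φ x (lo x)) (fun x => φ x (hi x)) :=
    image_piMap (fun x hx => hmono x (hKS hx)) (fun x hx => hle x (hKS hx)) (fun x hx => hc x (hKS hx))
  -- on that set the two inverses agree
  have hagree : ∀ q ∈ E '' piRegion K lo hi,
      paramInv S lo hi φ q.1 q.2 = (Function.invFunOn E (piRegion K lo hi) q).2 := by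
    intro q hq
    have h1 : Function.invFunOn E (piRegion K lo hi) q ∈ piRegion K lo hi := Function.invFunOn_mem hq
    have h2 : E (Function.invFunOn E (piRegion K lo hi) q) = q := Function.invFunOn_eq hq
    have hq' : q ∈ E '' piRegion S lo hi := by
      obtain ⟨p, hp, rfl⟩ := hq
      exact ⟨p, ⟨hKS hp.1, hp.2⟩, rfl⟩
    have h3 : Function.invFunOn E (piRegion S lo hi) q ∈ piRegion S lo hi := Function.invFunOn_mem hq'
    have h4 : E (Function.invFunOn E (piRegion S lo hi) q) = q := Function.invFunOn_eq hq'
    have heq : Function.invFunOn E (piRegion S lo hi) q = Function.invFunOn E (piRegion K lo hi) q :=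
      injOn_piMap hmono h3 ⟨hKS h1.1, h1.2⟩ (h4.trans h2.symm)
    have : paramInv S lo hi φ q.1 q.2 = (Function.invFunOn E (piRegion S lo hi) q).2 := rfl
    rw [this, heq]
  -- continuity within the big region at `(x₀, r₀)` from continuity within the `K`-part
  have hsub : piRegion K (fun x => φ x (lo x)) (fun x => φ x (hi x)) ∈
      𝓝[piRegion S (fun x => φ x (lo x)) (fun x => φ x (hi x))] (x₀, r₀) := by
    -- `{p | p.1 ∈ K}` is a neighbourhood within, since `K ∈ 𝓝[S] x₀`
    obtain ⟨U, hU, hUo, hx₀U⟩ : ∃ U, U ∩ S ⊆ K ∧ IsOpen U ∧ x₀ ∈ U := by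
      obtain ⟨U, hUo, hxU, hUK⟩ := mem_nhdsWithin.1 hKn
      exact ⟨U, hUK, hUo, hxU⟩
    refine mem_nhdsWithin.2 ⟨Prod.fst ⁻¹' U, hUo.preimage continuous_fst, hx₀U, ?_⟩
    rintro ⟨x, r⟩ ⟨hxU, hx⟩
    exact ⟨hU ⟨hxU, hx.1⟩, hx.2⟩
  have hcw : ContinuousWithinAt (fun p : X × ℝ => paramInv S lo hi φ p.1 p.2)
      (piRegion K (fun x => φ x (lo x)) (fun x => φ x (hi x))) (x₀, r₀) := by
    have hmem₀ : (x₀, r₀) ∈ piRegion K (fun x => φ x (lo x)) (fun x => φ x (hi x)) :=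
      ⟨mem_of_mem_nhdsWithin hp₀.1 hKn, hp₀.2⟩
    have h := (continuous_snd.comp_continuousOn hcontK).congr (fun q hq => hagree q hq)
    rw [himK] at h
    exact h (x₀, r₀) hmem₀
  exact hcw.mono_of_mem_nhdsWithin hsub

/-- Open subsets of `ℝᵏ` are locally compact in the relative sense used above. [folklore] -/
theorem exists_compact_mem_nhdsWithin_of_isOpen {k : ℕ} {U : Set (Fin k → ℝ)} (hU : IsOpen U)
    {x : Fin k → ℝ} (hx : x ∈ U) : ∃ K ⊆ U, IsCompact K ∧ K ∈ 𝓝[U] x := by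
  obtain ⟨ε, hε, hball⟩ := Metric.isOpen_iff.1 hU x hx
  refine ⟨closedBall x (ε / 2), (closedBall_subset_ball (by linarith)).trans hball,
    isCompact_closedBall _ _, mem_nhdsWithin_of_mem_nhds (closedBall_mem_nhds x (by linarith))⟩

end ParamInv

/-! ### Parametric inverse: semialgebraicity (snoc coordinates, graph swap) -/

section ParamInvSA

variable {m : ℕ}

/-- **The fibrewise inverse of a semialgebraic family is semialgebraic** (its graph is the graph
of `φ` with the last two coordinates swapped). [cite: Pawlucki2024, Prop. 2.5 (proof, Part I)] -/
theorem isSemialgebraicFunOn_paramInv {S : Set (Fin m → ℝ)} (hS : IsSemialgebraic ℝ S)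
    {lo hi : (Fin m → ℝ) → ℝ} {φ : (Fin m → ℝ) → ℝ → ℝ}
    (hlo : IsSemialgebraicFunOn ℝ S lo) (hhi : IsSemialgebraicFunOn ℝ S hi)
    (hφ : IsSemialgebraicFunOn ℝ {z : Fin (m + 1) → ℝ | Fin.init z ∈ S ∧ lo (Fin.init z) ≤ z (Fin.last m) ∧
      z (Fin.last m) ≤ hi (Fin.init z)} (fun z => φ (Fin.init z) (z (Fin.last m))))
    (hmono : ∀ x ∈ S, StrictMonoOn (φ x) (Icc (lo x) (hi x))) (hle : ∀ x ∈ S, lo x ≤ hi x)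
    (hc : ∀ x ∈ S, ContinuousOn (φ x) (Icc (lo x) (hi x))) :
    IsSemialgebraicFunOn ℝ {w : Fin (m + 1) → ℝ | Fin.init w ∈ S ∧ φ (Fin.init w) (lo (Fin.init w)) ≤ w (Fin.last m) ∧
      w (Fin.last m) ≤ φ (Fin.init w) (hi (Fin.init w))}
      (fun w => paramInv S lo hi φ (Fin.init w) (w (Fin.last m))) := by
  classical
  -- the two regions (in snoc coordinates)
  have hR : IsSemialgebraic ℝ {z : Fin (m + 1) → ℝ | Fin.init z ∈ S ∧ lo (Fin.init z) ≤ z (Fin.last m) ∧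
      z (Fin.last m) ≤ hi (Fin.init z)} := by
    have h1 := IsSemialgebraicFunOn.isSemialgebraic_setOf_ge tarski_seidenberg_real_holds hlo
    have h2 := IsSemialgebraicFunOn.isSemialgebraic_setOf_le tarski_seidenberg_real_holds hhi
    convert h1.inter h2 using 1
    ext z; simp only [mem_setOf_eq, mem_inter_iff]; tauto
  -- bounds `x ↦ φ x (lo x)`, `x ↦ φ x (hi x)` are semialgebraic on `S`
  have hbound : ∀ g : (Fin m → ℝ) → ℝ, IsSemialgebraicFunOn ℝ S g → (∀ x ∈ S, g x ∈ Icc (lo x) (hi x)) →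
      IsSemialgebraicFunOn ℝ S (fun x => φ x (g x)) := by
    intro g hg hgm
    have hmap := isSemialgebraicMapOn_snoc hS hg
    have hmaps : MapsTo (fun x : Fin m → ℝ => (Fin.snoc x (g x) : Fin (m + 1) → ℝ)) S
        {z : Fin (m + 1) → ℝ | Fin.init z ∈ S ∧ lo (Fin.init z) ≤ z (Fin.last m) ∧ z (Fin.last m) ≤ hi (Fin.init z)} := by
      intro x hx
      simp only [mem_setOf_eq, Fin.init_snoc, Fin.snoc_last]
      exact ⟨hx, (hgm x hx).1, (hgm x hx).2⟩
    have h := IsSemialgebraicFunOn.comp_isSemialgebraicMapOn_holds hφ hmap hmaps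
    refine h.congr fun x _ => ?_
    simp [Function.comp]
  have hφlo := hbound lo hlo fun x hx => ⟨le_rfl, hle x hx⟩
  have hφhi := hbound hi hhi fun x hx => ⟨hle x hx, le_rfl⟩
  have hDom : IsSemialgebraic ℝ {w : Fin (m + 1) → ℝ | Fin.init w ∈ S ∧ φ (Fin.init w) (lo (Fin.init w)) ≤ w (Fin.last m) ∧
      w (Fin.last m) ≤ φ (Fin.init w) (hi (Fin.init w))} := by
    have h1 := IsSemialgebraicFunOn.isSemialgebraic_setOf_ge tarski_seidenberg_real_holds hφlo
    have h2 := IsSemialgebraicFunOn.isSemialgebraic_setOf_le tarski_seidenberg_real_holds hφhi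
    convert h1.inter h2 using 1
    ext z; simp only [mem_setOf_eq, mem_inter_iff]; tauto
  rw [isSemialgebraicFunOn_iff]
  have hΓφ := isSemialgebraicFunOn_iff.mp hφ
  let σ : Fin (m + 1 + 1) → Fin (m + 1 + 1) :=
    Equiv.swap (Fin.castSucc (Fin.last m)) (Fin.last (m + 1))
  have hpre := hΓφ.preimage_comp σ
  convert hDom.setOf_init_mem.inter hpre using 1
  ext q
  simp only [mem_setOf_eq, mem_inter_iff, Set.mem_preimage]
  have hlast : (q ∘ σ) (Fin.last (m + 1)) = q (Fin.castSucc (Fin.last m)) := by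
    show q (Equiv.swap (Fin.castSucc (Fin.last m)) (Fin.last (m + 1)) (Fin.last (m + 1))) = _
    rw [Equiv.swap_apply_right]
  have hinit_last : Fin.init (q ∘ σ) (Fin.last m) = q (Fin.last (m + 1)) := by
    show q (Equiv.swap (Fin.castSucc (Fin.last m)) (Fin.last (m + 1)) (Fin.castSucc (Fin.last m))) = _
    rw [Equiv.swap_apply_left]
  have hinit_init : Fin.init (Fin.init (q ∘ σ)) = Fin.init (Fin.init q) := by
    funext i
    show q (Equiv.swap (Fin.castSucc (Fin.last m)) (Fin.last (m + 1))
      (Fin.castSucc (Fin.castSucc i))) = q (Fin.castSucc (Fin.castSucc i))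
    rw [Equiv.swap_apply_of_ne_of_ne]
    · intro h
      have h' := congrArg Fin.val h
      simp at h'
      exact absurd h' (Nat.ne_of_lt i.2)
    · intro h
      have h' := congrArg Fin.val h
      simp at h'
      omega
  have hinit : Fin.init (q ∘ σ) = Fin.snoc (Fin.init (Fin.init q)) (q (Fin.last (m + 1))) := by
    rw [← hinit_init, ← hinit_last, Fin.snoc_init_self]
  have hq_init : Fin.init q (Fin.last m) = q (Fin.castSucc (Fin.last m)) := rfl
  rw [hinit, hlast]
  simp only [Fin.init_snoc, Fin.snoc_last]
  constructor
  · rintro ⟨hqD, hψ⟩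
    refine ⟨hqD, ?_⟩
    have hxr : Fin.init (Fin.init q) ∈ S ∧ q (Fin.castSucc (Fin.last m)) ∈
        Icc (φ (Fin.init (Fin.init q)) (lo (Fin.init (Fin.init q)))) (φ (Fin.init (Fin.init q)) (hi (Fin.init (Fin.init q)))) := by
      rw [hq_init] at hqD; exact ⟨hqD.1, hqD.2.1, hqD.2.2⟩
    have hspec := paramInv_spec hmono hle hc hxr.1 hxr.2
    rw [hq_init] at hψ
    rw [hψ]
    exact ⟨⟨hxr.1, hspec.1.1, hspec.1.2⟩, hspec.2.symm⟩
  · rintro ⟨hqD, ⟨hxS, ht1, ht2⟩, hφt⟩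
    refine ⟨hqD, ?_⟩
    rw [hq_init, hφt]
    exact (paramInv_apply hmono hxS ⟨ht1, ht2⟩).symm

end ParamInvSA

end Literature.ModelTheory.ExponentialFields
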